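import Summits.AtomisticToContinuum.FouriersLaw.Theses.MatthiessenLadder

/-!
# `MatthiessenLadder.Assembly` — PROVED

Route `AtomisticToContinuum/FouriersLaw/MatthiessenLadder`, assembly item
`stmt-AtomisticToContinuum-12782` (`Assembly`):

  `IncrementGlue → PrefixIncrementBounds → PrefixSteadyStates → NessUnique →
   FiniteResponseOfUnique → BoundedResponseConverges → FouriersLaw`.

The route file carries the planner-authored, sorry-free D-0027 §2.1 deciding theorem
`Summit.AtomisticToContinuum.FouriersLaw.Theses.MatthiessenLadder.closes`, whose type is literally
the body of `Assembly`; this file records the item-closing theorem whose type is the route decl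
`Assembly` by name.  For the mathematics (bounded response along every steady-state family from the
telescoped Matthiessen increments via `IncrementGlue`; clause (i) of `FouriersLawFor` from the
in-tree fact `pinnedChain_exists_isSteadyState` plus weak-NESS uniqueness `NessUnique`; clause (ii):
canonical family by choice, response coefficients from `FiniteResponseOfUnique`, bounded ⇒
convergent to a positive limit by `BoundedResponseConverges`, and agreement of every other
steady-state family with the canonical one for `|δ| < 2T` by uniqueness) see the proof of `closes`
in the route file.  No named-fact hypotheses: the theorem is unconditional (its axioms are those of
`closes`: `propext`, `Classical.choice`, `Quot.sound`).
-/

namespace Summit.AtomisticToContinuum.FouriersLaw.Theorems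

/-- Settles `stmt-AtomisticToContinuum-12782` (assembly of route `MatthiessenLadder`): the
telescoping glue `IncrementGlue`, the cruxes `PrefixIncrementBounds` (Matthiessen increments along
the prefix ladder) and `PrefixSteadyStates` (steady states and finite response of the rungs), weak
steady-state uniqueness `NessUnique`, existence of the finite-`N` response limits
`FiniteResponseOfUnique` and the import slot `BoundedResponseConverges` imply the sub-problem
statement `FouriersLaw`.  Proof: the route's deciding theorem `closes` (after unfolding `Assembly`).
[folklore] -/
theorem matthiessenLadder_assembly_proof :
    Summit.AtomisticToContinuum.FouriersLaw.Theses.MatthiessenLadder.Assembly := by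
  unfold Summit.AtomisticToContinuum.FouriersLaw.Theses.MatthiessenLadder.Assembly
  exact Summit.AtomisticToContinuum.FouriersLaw.Theses.MatthiessenLadder.closes

end Summit.AtomisticToContinuum.FouriersLaw.Theorems
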